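import Literature.AlgebraicGeometry.GroupSchemes.BarsottiTateGroupConnectedPartTangent
import Literature.AlgebraicGeometry.GroupSchemes.BTGroupConnectedDimOneOfTangentRank
import Literature.AlgebraicGeometry.GroupSchemes.UnitComponentOfFiniteGroupScheme
import Literature.AlgebraicGeometry.GroupSchemes.UnitAugmentationIdealStalk
import Literature.AlgebraicGeometry.GroupSchemes.DiagonalizableOfEtaleCartierDual
import Literature.AlgebraicGeometry.GroupSchemes.InfinitesimalToUnramifiedTrivial
import Literature.AlgebraicGeometry.Motives.AbelianVarietyEtaleIsogenyFrobeniusKernel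
import HarnessLib

/-!
# A finite group scheme with zero cotangent space at the unit is étale; the two banal Frobenius-kernel laws (étale ∕ multiplicative type)
# ([Tate 1997] (3.7); [Görtz–Wedhorn I] (6.4); [Tate 1967] §2.2; [Demazure 1972] III §6)

Topic `Literature/AlgebraicGeometry/GroupSchemes`; namespace `Literature.AlgebraicGeometry.GroupSchemes` (+ `…Motives.AbelianVariety` for §3).  THEOREMS
ONLY (no definition, no named fact, no instance, no notation, no `sorry`).  Cell `hodgecm-mathlib` (D-0151), FLOOR 0, P6 «MOD programme» (crux hLiu418 =
stmt-HodgeConjecture-24832, `--supports`, count-neutral): organ **(C1) FILE 1 «BLOCK TYPE FROM THE COTANGENT RANK»** (LEAD F0P6-plan (g2) 2026-09-01T21:20:32Z,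
GEN census `CENSUS-RGD-ASSEMBLY.v1` 09be7b9d row (iii) «banal blocks», reading B-p18 (g37) 21:17:00Z): the banal places `u ∉ {w, c•w}` of the Frobenius-kernel
law (rL) are those where the `u`-block of `A[p^∞]` is ÉTALE (`Ker F_q ∩ block = 1`) or of MULTIPLICATIVE TYPE (`Ker F_q ∩ block ⊇ block[q]`); this file
decides the type from ONE number — the cotangent rank of the block at the unit (`0` ⇒ étale), resp. of the conjugate block (dual étale ⇒ multiplicative)
— and states the two laws in the pin currency of (BLF) ∕ ★ `TorsionLayerBlockIdempotents` (`t : T ⟶ E`, `i : E ↪ A`).  The «CM type» thus enters only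
through the block signatures ((S7)∕(U1-d) `hcount`), door-independent.  HC_CM is proved only modulo the printed citations until rung 0 closes; this file is
generic and changes no count.

THE MATHEMATICS.  [Tate1997FiniteFlatGroupSchemes] (3.7): a finite group scheme `G` over a henselian local base has a unit component `G⁰` (open and
closed, connected; ★ `exists_unitComponent`), and `G` is étale iff `G⁰` is trivial; [GortzWedhorn2020] (6.4) Def. 6.2 ∕ Prop. 6.7: the Zariski cotangent
space `I_e ∕ I_e²` at the unit is local, so `G` and `G⁰` have the same cotangent rank (★ `finrank_cotangent_ker_unit_eq_of_unitComponent`); `Γ(G⁰)` is a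
local Artin `k`-algebra with residue field `k` (the unit; ★ `isLocalRing_alg_of_connectedSpace`, ★ `TangentHom.ker_eq_maximalIdeal`), and if
`𝔪 ∕ 𝔪² = 0` then `𝔪 = 0` (Nakayama; Mathlib `IsLocalRing.subsingleton_cotangentSpace_iff`), i.e. `Γ(G⁰) = k`, `G⁰ ≅ Spec k`, so the unit of `G` is an
open immersion and `G` is étale (★ `etale_and_natCard_eq_of_isUnitComponent_of_isIso`, `k = k̄`).  The LAWS ([Tate1967] §2.2; [MumfordAV1970] §14–§15):
for an étale closed subgroup `i : E ↪ A` of an abelian variety, a `T`-point `t` of `E` killed by `F^{(r)}_{A∕k}` is trivial — `Ker(i ≫ F)` is a closed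
subscheme of the one-point `Ker F` (★ `subsingleton_ker_relFrobenius_left`) and a closed subgroup of the étale `E`, hence the trivial group (★
`isIso_unit_of_subsingleton_of_isClosedImmersion_of_etale`); for a finite commutative `E` of MULTIPLICATIVE TYPE (étale Cartier dual, `k = k̄`) killed by
`p^r`, `i ≫ F^{(r)} = 1` ([Demazure1972] III §6; ★ `comp_relFrobeniusOver_eq_one_of_etale_cartierDual_of_id_pow_eq_one`); and étaleness of a Cartier dual
is read through any block duality `eW : W ≅ 𝒢l^D` (★ `blockReduction`'s output): `W` étale ⇒ `𝒢l^D` étale.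

* §1 (algebra) `finrank_eq_one_of_finrank_cotangent_ker_eq_zero` — local Noetherian augmented `k`-algebra with `(ker ε)∕(ker ε)² = 0` has `dim_k = 1`.
* §2 **`etale_of_finrank_cotangent_unit_eq_zero`** — finite `k`-group scheme (`k = k̄`) with zero unit cotangent rank is étale.
* §3 the banal laws: **`comp_comp_relFrobenius_eq_one_iff_of_etale`** (étale type: `(t ≫ i) ≫ F^{(r)} = 1 ↔ t = 1`), its two-step-pin form
  `comp_comp_comp_relFrobenius_eq_one_iff_of_etale` (`i = j𝒢 ≫ j`), **`comp_comp_relFrobenius_eq_one_of_etale_cartierDual`** (multiplicative type: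
  `(t ≫ i) ≫ F^{(r)} = 1`), and `etale_hom_of_iso` (`W ≅ 𝒢l^D`, `W` étale ⇒ `𝒢l^D` étale).

## References
* [Tate1997FiniteFlatGroupSchemes] J. Tate, *Finite flat group schemes*, in: Modular Forms and Fermat's Last Theorem (1997), (3.7).
* [GortzWedhorn2020] U. Görtz, T. Wedhorn, *Algebraic Geometry I* (2nd ed. 2020), (6.4) Definition 6.2, Proposition 6.7.
* [Tate1967] J. T. Tate, *p-divisible groups*, Proc. Conf. Local Fields (Driebergen 1966), Springer (1967), §2.2.
* [MumfordAV1970] D. Mumford, *Abelian Varieties* (1970), §14, §15 (p. 146).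
* [Demazure1972] M. Demazure, *Lectures on p-divisible groups*, LNM 302 (1972), Ch. III §6.
-/

set_option autoImplicit false

-- Mathlib's `Over`/`Scheme` APIs are stated across semireducible wrappers (as in the ★ `GroupSchemes/*` files).
set_option backward.isDefEq.respectTransparency false

noncomputable section

universe u

open CategoryTheory CategoryTheory.Limits AlgebraicGeometry MonoidalCategory CartesianMonoidalCategory IsLocalRing
open scoped MonObj

namespace Literature.AlgebraicGeometry.GroupSchemes

open Literature.AlgebraicGeometry.Motives Literature.AlgebraicGeometry.GroupSchemes.GroupSchemeKernel AffineGroupScheme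

/-! ## §1 Algebra: an augmented local Noetherian `k`-algebra with zero cotangent space at the augmentation is `k` -/

/-- **`(ker ε) ∕ (ker ε)² = 0` ⇒ `dim_k A = 1`** for a local Noetherian `k`-algebra `A` with an augmentation `ε : A → k`: `ker ε = 𝔪_A` (★
`TangentHom.ker_eq_maximalIdeal`), so `𝔪 ∕ 𝔪² = 0`, so `𝔪 = 0` by Nakayama (Mathlib `IsLocalRing.subsingleton_cotangentSpace_iff`: `A` is a field), so `ε` is
injective as well as surjective, an isomorphism `A ≃ k`. [cite: GortzWedhorn2020, (6.4) Definition 6.2] [cite: Tate1997FiniteFlatGroupSchemes, (3.7)] -/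
theorem finrank_eq_one_of_finrank_cotangent_ker_eq_zero {k : Type u} [Field k] {A : Type u} [CommRing A] [Algebra k A] [IsLocalRing A] [IsNoetherianRing A]
    (ε : A →ₐ[k] k) (h0 : Module.finrank k (RingHom.ker ε.toRingHom).Cotangent = 0) : Module.finrank k A = 1 := by
  have hcot : Module.finrank (ResidueField A) (CotangentSpace A) = 0 := by
    rw [Literature.AlgebraicGeometry.Morphisms.finrank_residueField_cotangentSpace_eq_finrank_ker_cotangent ε]
    exact h0
  haveI : Subsingleton (CotangentSpace A) := Module.finrank_zero_iff.mp hcot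
  have hF : IsField A := IsLocalRing.subsingleton_cotangentSpace_iff.mp inferInstance
  letI := hF.toField
  have hbij : Function.Bijective ε :=
    ⟨ε.toRingHom.injective, Literature.RingTheory.CompleteIntersection.augmentation_surjective ε⟩
  rw [(AlgEquiv.ofBijective ε hbij).toLinearEquiv.finrank_eq, Module.finrank_self]

/-! ## §2 A finite group scheme over `k = k̄` with zero cotangent space at the unit is étale -/

section Etale

variable {k : Type u} [Field k]

/-- The augmentation `Γ(G, 𝒪_G) → k` of the unit section, as a `k`-algebra map (`Γ(η_G)` followed by `Γ(Spec k) ≅ k`; ★ `ΓSpecIso_unit_appTop_algebraMap`),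
with its kernel = the augmentation ideal `I_e = ker Γ(η_G)`. [cite: GortzWedhorn2020, (6.4) Definition 6.2] -/
theorem exists_augmentation_ker_eq (G : Over (Spec (.of k))) [GrpObj G] :
    ∃ ε : Alg G →ₐ[k] k, RingHom.ker ε.toRingHom = (RingHom.ker ((η[G] : 𝟙_ (Over (Spec (.of k))) ⟶ G).left.appTop.hom) : Ideal (Alg G)) := by
  let e₀ : Alg G →+* k := (Scheme.ΓSpecIso (.of k)).hom.hom.comp ((η[G] : 𝟙_ (Over (Spec (.of k))) ⟶ G).left.appTop.hom)
  refine ⟨{ toRingHom := e₀, commutes' := fun c => ΓSpecIso_unit_appTop_algebraMap G c }, ?_⟩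
  exact RingHom.ker_comp_of_injective _ (Scheme.ΓSpecIso (.of k)).commRingCatIsoToRingEquiv.injective

/-- **A FINITE GROUP SCHEME OVER AN ALGEBRAICALLY CLOSED FIELD WHOSE COTANGENT SPACE AT THE UNIT VANISHES IS ÉTALE** (`dim_k I_e ∕ I_e² = 0` for the
augmentation ideal `I_e = ker Γ(η_G) ⊆ Γ(G, 𝒪_G)`): the unit component `G⁰` (★ `exists_unitComponent`) has the same cotangent rank (★
`finrank_cotangent_ker_unit_eq_of_unitComponent`), its affine algebra is local (★ `isLocalRing_alg_of_connectedSpace`) hence `= k` (§1), so `G⁰ ≅ Spec k` (★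
`isIso_hom_of_finrank_eq_one`) and `G` is étale (★ `etale_and_natCard_eq_of_isUnitComponent_of_isIso`). [cite: Tate1997FiniteFlatGroupSchemes, (3.7)]
[cite: GortzWedhorn2020, (6.4) Definition 6.2, Proposition 6.7] -/
theorem etale_of_finrank_cotangent_unit_eq_zero [IsAlgClosed k] (G : Over (Spec (.of k))) [GrpObj G] [IsFinite G.hom]
    (h0 : Module.finrank k (RingHom.ker ((η[G] : 𝟙_ (Over (Spec (.of k))) ⟶ G).left.appTop.hom) : Ideal (Alg G)).Cotangent = 0) :
    Etale G.hom := by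
  haveI : IsAffine G.left := isAffine_of_isAffineHom G.hom
  obtain ⟨U, instU, jU, hmon, hop, hcl, hconn⟩ := exists_unitComponent k G
  haveI := hmon
  haveI := hop
  haveI := hcl
  haveI : IsFinite U.hom := (isFinite_and_flat_of_immersions jU).1
  haveI : IsAffine U.left := isAffine_of_isAffineHom U.hom
  -- the unit component has the same (zero) cotangent rank
  have hU0 : Module.finrank k (RingHom.ker ((η[U] : 𝟙_ (Over (Spec (.of k))) ⟶ U).left.appTop.hom) : Ideal (Alg U)).Cotangent = 0 := by
    rw [← finrank_cotangent_ker_unit_eq_of_unitComponent G U jU]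
    exact h0
  -- its affine algebra is local Artinian with residue field `k`, hence `= k`
  haveI : IsLocalRing (Alg U) := isLocalRing_alg_of_connectedSpace U hconn
  haveI : Module.Finite k (Alg U) := Alg.moduleFinite U
  haveI : IsArtinianRing (Alg U) := IsArtinianRing.of_finite k _
  obtain ⟨εU, hεU⟩ := exists_augmentation_ker_eq U
  have h1 : Module.finrank k (Alg U) = 1 :=
    finrank_eq_one_of_finrank_cotangent_ker_eq_zero εU (by rw [hεU]; exact hU0)
  -- so `U ≅ Spec k` over `k`, and `G` is étale
  have heU : U.left.isoSpec.hom ≫ Spec.map (CommRingCat.ofHom (algebraMap k (Alg U))) = U.hom :=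
    isoSpec_hom_comp_SpecMap_algebraMapΓ U.hom
  exact (etale_and_natCard_eq_of_isUnitComponent_of_finrank_eq_one k G U jU inferInstance ⟨hmon, hop, hcl, hconn⟩ (Alg U)
    U.left.isoSpec heU h1).1

end Etale

/-! ## §3 The two banal Frobenius-kernel laws, in pin currency -/

section CartierDual

variable {k : Type u} [Field k]

/-- **Étaleness of a Cartier dual read through a block duality**: if `eW : W ≅ G′` over `k` (e.g. `G′ = 𝒢l^D` and `eW` the block duality of ★
`blockReduction`) and `W → Spec k` is étale, then `G′ → Spec k` is étale. [cite: Tate1997FiniteFlatGroupSchemes, (3.7)] -/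
theorem etale_hom_of_iso {W G' : SchemeOver k} (eW : W ≅ G') [Etale W.hom] : Etale G'.hom := by
  rw [← Over.w eW.inv]
  infer_instance

end CartierDual

end Literature.AlgebraicGeometry.GroupSchemes

namespace Literature.AlgebraicGeometry.Motives.AbelianVariety

open Literature.AlgebraicGeometry.GroupSchemes Literature.AlgebraicGeometry.GroupSchemes.GroupSchemeKernel
  Literature.AlgebraicGeometry.GroupSchemes.AffineGroupScheme

variable {k : Type u} [Field k] (p : ℕ) [ExpChar k p] (r : ℕ) (A : AbelianVariety k)

/-- **THE ÉTALE BANAL LAW: `Ker F_q ∩ E = 1`.**  For an ÉTALE closed subgroup `i : E ↪ A` of an abelian variety over a field and any `T`-point `t` of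
`E`: `(t ≫ i) ≫ F^{(r)}_{A∕k} = 1 ↔ t = 1`.  (`Ker(i ≫ F^{(r)})` is a closed subscheme of the one-point `Ker F^{(r)}` — ★ `subsingleton_ker_relFrobenius_left` —
and a closed subgroup of the étale `E`, hence the trivial group, ★ `isIso_unit_of_subsingleton_of_isClosedImmersion_of_etale`.)
[cite: Tate1967, §2.2] [cite: MumfordAV1970, §14, §15 (p. 146)] [cite: Tate1997FiniteFlatGroupSchemes, (3.7)] -/
theorem comp_comp_relFrobenius_eq_one_iff_of_etale {E : SchemeOver k} [GrpObj E] [Etale E.hom] (i : E ⟶ A.X) [IsMonHom i]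
    [IsClosedImmersion i.left] {T : SchemeOver k} (t : T ⟶ E) :
    (t ≫ i) ≫ (A.relFrobenius p r).hom.hom.hom = 1 ↔ t = 1 := by
  refine ⟨fun ht => ?_, fun ht => by rw [ht, MonObj.one_comp, MonObj.one_comp]⟩
  let χ : E ⟶ (A.frobeniusTwist p r).X := i ≫ (A.relFrobenius p r).hom.hom.hom
  haveI : IsClosedImmersion (kerι χ).left := isClosedImmersion_kerι_left_of_isSeparated χ
  -- `Ker χ ↪ Ker F^{(r)}` is a closed immersion into a one-point scheme
  have hle : (kerι χ ≫ i) ≫ (A.relFrobenius p r).hom.hom.hom = 1 := by rw [Category.assoc, kerι_comp]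
  haveI : IsClosedImmersion (kerLift (f := (A.relFrobenius p r).hom.hom.hom) (kerι χ ≫ i) hle).left := by
    haveI := isClosedImmersion_kerι_left_of_isSeparated (A.relFrobenius p r).hom.hom.hom
    haveI : IsClosedImmersion ((kerLift (f := (A.relFrobenius p r).hom.hom.hom) (kerι χ ≫ i) hle).left ≫
        (kerι (A.relFrobenius p r).hom.hom.hom).left) := by
      rw [← Over.comp_left, kerLift_ι, Over.comp_left]
      infer_instance
    exact IsClosedImmersion.of_comp _ (kerι (A.relFrobenius p r).hom.hom.hom).left
  haveI : Subsingleton ↥(ker (A.relFrobenius p r).hom.hom.hom).left := A.subsingleton_ker_relFrobenius_left p r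
  haveI : Subsingleton ↥(ker χ).left :=
    (kerLift (f := (A.relFrobenius p r).hom.hom.hom) (kerι χ ≫ i) hle).left.isClosedEmbedding.injective.subsingleton
  -- a one-point closed subgroup of the étale `E` is trivial
  obtain ⟨hiso, -⟩ := isIso_unit_of_subsingleton_of_isClosedImmersion_of_etale (kerι χ)
  have hfac : kerLift (f := χ) t ht = toUnit T ≫ η[ker χ] := by
    rw [← Category.comp_id (kerLift (f := χ) t ht), ← IsIso.inv_hom_id (η[ker χ]), ← Category.assoc]
    congr 1
    exact toUnit_unique _ _
  rw [← kerLift_ι (f := χ) t ht, hfac, Category.assoc, one_comp_kerι, ← Hom.one_def]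

/-- The same with the pin written in two steps `E ↪ G ↪ A` (the (BLF) tokens `(t ≫ j𝒢 ≫ j) ≫ F^{(r)}` for a block `j𝒢 : 𝒢u ↪ G = A[q]`): for `𝒢u` étale,
`((t ≫ j𝒢) ≫ j) ≫ F^{(r)}_{A∕k} = 1 ↔ t = 1`. [cite: Tate1967, §2.2] [cite: Tate1997FiniteFlatGroupSchemes, (3.7)] -/
theorem comp_comp_comp_relFrobenius_eq_one_iff_of_etale {G E : SchemeOver k} [GrpObj G] [GrpObj E] [Etale E.hom] (j : G ⟶ A.X) [IsMonHom j]
    [IsClosedImmersion j.left] (j𝒢 : E ⟶ G) [IsMonHom j𝒢] [IsClosedImmersion j𝒢.left] {T : SchemeOver k} (t : T ⟶ E) :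
    ((t ≫ j𝒢) ≫ j) ≫ (A.relFrobenius p r).hom.hom.hom = 1 ↔ t = 1 := by
  haveI : IsClosedImmersion (j𝒢 ≫ j).left := by rw [Over.comp_left]; infer_instance
  rw [Category.assoc t]
  exact A.comp_comp_relFrobenius_eq_one_iff_of_etale p r (j𝒢 ≫ j) t

/-- **THE MULTIPLICATIVE BANAL LAW: `Ker F_q ∩ E = E` on the `q`-layer.**  For a finite commutative closed subgroup `i : E ↪ A` (homomorphism) of
MULTIPLICATIVE TYPE — étale Cartier dual, `k = k̄` — killed by `q = p^r` (`(𝟙 E)^q = 1`, e.g. `E ⊆ A[q]`): every `T`-point of `E` is killed by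
`F^{(r)}_{A∕k}`, `(t ≫ i) ≫ F^{(r)} = 1` (★ `comp_relFrobeniusOver_eq_one_of_etale_cartierDual_of_id_pow_eq_one`). [cite: Demazure1972, Ch. III §6]
[cite: Tate1967, §2.2] [cite: Tate1997FiniteFlatGroupSchemes, (3.7)] -/
theorem comp_comp_relFrobenius_eq_one_of_etale_cartierDual [IsAlgClosed k] {E : SchemeOver k} [GrpObj E] [IsCommMonObj E] [IsAffine E.left]
    [Module.Finite k (Alg E)] [Etale (cartierDual E).hom] (i : E ⟶ A.X) [IsMonHom i] (hq : (𝟙 E) ^ p ^ r = 1) {T : SchemeOver k} (t : T ⟶ E) :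
    (t ≫ i) ≫ (A.relFrobenius p r).hom.hom.hom = 1 := by
  have h := comp_relFrobeniusOver_eq_one_of_etale_cartierDual_of_id_pow_eq_one p r A.X i (IsMonHom.one_hom i) hq
  rw [Category.assoc, AbelianVariety.relFrobenius_hom_hom_hom, h, MonObj.comp_one]

end Literature.AlgebraicGeometry.Motives.AbelianVariety

end
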